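import Mathlib
import Summits.ResolutionOfSingularities.ResolutionOfSingularities.Theorems.RadicialJungCleanModelsCleanProp44VeryNearOpens
import Summits.ResolutionOfSingularities.ResolutionOfSingularities.Theorems.MarkedTransferCampaignW46ThreefoldsGammaFreeGlobalPatching
import Literature.AlgebraicGeometry.Resolution.BlowupsLocal
import HarnessLib

/-!
# Route `RadicialJung`, crux `CleanModels` (stmt-ResolutionOfSingularities-15917), line `Sketch` rev 35, stub 6 `stub_cleanProp44` (X44c):
# «no very near point» ASCENDS along blowing ups away from the point

Seat decomp-res-hand-2 g15 (structural hand), companion of ✓ `…CleanProp44VeryNearOpens.lean` (the condition DESCENDS to opens).  Here: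
**`forall_near_two_le_of_isBlowup_of_not_mem`** — if `π₁ : X₁ → X` is a blowing up along a closed `Y₁ ∌ x` and `x' ∈ X₁` is the point over the
closed point `x`, then «every blowing up of `X` at `x` has `τ ≥ 2` at its closed threefold near points» (for `(J, μ)`) implies the same for `X₁` at
`x'` (for the controlled transform `(J₁, μ)`).  Mechanism: over the open complement `U` of `Y₁` the blowing up `π₁` is an isomorphism
(✓ `IsBlowup.isIso_compl`); a blowing up `b` of `X₁` at `x'` restricted over `W = π₁⁻¹ U` and composed with that isomorphism is a blowing up of `U`
at `x` (✓ `IsBlowup.restrict`, ✓ `IsBlowup.comp_iso`); the condition descends from `X` to `U` (✓ `forall_near_two_le_point_of_forall_near_two_le`);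
the controlled transforms match (✓ `comap_controlledTransform_of_flat`, ✓ `CampaignW46.controlledTransform_top`), and `τ`, orders, embedding
dimension travel along the open immersion `b⁻¹W ↪ B`.  This is the step that lets the «isolated τ = 1 points without very near points» regime
propagate along clean-permissible sequences.

Honest framing: OURS; plumbing over Görtz–Wedhorn Prop. 13.91; nothing here proves X44c, any case of `CleanModels`, or resolution of singularities
in characteristic `p`. [cite: GortzWedhorn2020, Prop. 13.91] [cite: BierstoneGrigorievMilmanWlodarczyk2011, §3.2 with Thm. 8.0.5]
-/

noncomputable section

set_option linter.dupNamespace false -- mandated namespace of this single-conjunct summit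

open CategoryTheory CategoryTheory.Limits AlgebraicGeometry TopologicalSpace IsLocalRing
open Literature.AlgebraicGeometry.Resolution Literature.AlgebraicGeometry.Motives
open Scheme.IdealSheafData
open Summit.ResolutionOfSingularities.ResolutionOfSingularities.Theorems.CP2008Prop44

namespace Summit.ResolutionOfSingularities.ResolutionOfSingularities.Theorems.RadicialJung.CleanModels

/-- The preimage of a closed point under the inclusion of an open containing it is the corresponding closed point of the open. [folklore] -/
private theorem preimage_singleton_opens {X : Scheme.{0}} (U : X.Opens) (x : X) (hxU : x ∈ U) (hcl : IsClosed ({x} : Set X)) :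
    ∃ hclU : IsClosed ({(⟨x, hxU⟩ : (U : Scheme.{0}))} : Set (U : Scheme.{0})),
      (⟨{x}, hcl⟩ : Closeds X).preimage U.ι.continuous = ⟨{(⟨x, hxU⟩ : (U : Scheme.{0}))}, hclU⟩ := by
  have hset : (fun u : (U : Scheme.{0}) => U.ι u) ⁻¹' {x} = {(⟨x, hxU⟩ : (U : Scheme.{0}))} := by
    ext u
    simp only [Set.mem_preimage, Set.mem_singleton_iff, Scheme.Opens.ι_apply]
    constructor
    · intro h; exact Subtype.ext h
    · intro h; rw [h]
  have hcl' : IsClosed ({(⟨x, hxU⟩ : (U : Scheme.{0}))} : Set (U : Scheme.{0})) := by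
    rw [← hset]
    exact hcl.preimage U.ι.continuous
  refine ⟨hcl', Closeds.ext ?_⟩
  rw [Closeds.coe_preimage]
  exact hset

set_option maxHeartbeats 1600000 in
-- long transport
/-- **«No very near point» ascends along a blowing up away from the point.**  See the module docstring.
[cite: GortzWedhorn2020, Prop. 13.91] [cite: BierstoneGrigorievMilmanWlodarczyk2011, §3.2 with Thm. 8.0.5] -/
theorem forall_near_two_le_of_isBlowup_of_not_mem {X X₁ : Scheme.{0}} [IsIntegral X] [IsNoetherian X] [IsIntegral X₁]
    (hX3 : topologicalKrullDim X ≤ 3) {Y₁ : Closeds X} {π₁ : X₁ ⟶ X} (hπ₁ : IsBlowup π₁ (vanishingIdeal Y₁))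
    (J : X.IdealSheafData) (μ : ℕ) (x : X) (hcl : IsClosed ({x} : Set X)) (hxY : x ∉ (Y₁ : Set X))
    (x' : X₁) (hx' : π₁ x' = x) (hcl' : IsClosed ({x'} : Set X₁))
    (hvn : ∀ (X₂ : Scheme.{0}) (π : X₂ ⟶ X), IsBlowup π (vanishingIdeal ⟨{x}, hcl⟩) →
      ∀ z : X₂, IsClosed ({z} : Set X₂) → π z = x →
        idealOrder (controlledTransform π (vanishingIdeal ⟨{x}, hcl⟩) J μ) z = μ →
        (maximalIdeal (X₂.presheaf.stalk z)).spanFinrank = 3 →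
        ∀ hr : IsRegularLocalRing (X₂.presheaf.stalk z), 2 ≤ @stalkTau X₂ (controlledTransform π (vanishingIdeal ⟨{x}, hcl⟩) J μ) z hr μ) :
    ∀ (B : Scheme.{0}) (b : B ⟶ X₁), IsBlowup b (vanishingIdeal ⟨{x'}, hcl'⟩) →
      ∀ z : B, IsClosed ({z} : Set B) → b z = x' →
        idealOrder (controlledTransform b (vanishingIdeal ⟨{x'}, hcl'⟩) (controlledTransform π₁ (vanishingIdeal Y₁) J μ) μ) z = μ →
        (maximalIdeal (B.presheaf.stalk z)).spanFinrank = 3 →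
        ∀ hr : IsRegularLocalRing (B.presheaf.stalk z),
          2 ≤ @stalkTau B (controlledTransform b (vanishingIdeal ⟨{x'}, hcl'⟩) (controlledTransform π₁ (vanishingIdeal Y₁) J μ) μ) z hr μ := by
  intro B b hb z hzcl hbz hordz hdz hrz
  haveI : IsLocallyNoetherian X₁ := hπ₁.isLocallyNoetherian
  haveI : IsLocallyNoetherian B := hb.isLocallyNoetherian
  -- the open complement `U` of the centre, over which `π₁` is an isomorphism
  obtain ⟨U, hUdef⟩ : ∃ U : X.Opens, U = ⟨((vanishingIdeal Y₁).support : Set X)ᶜ, (vanishingIdeal Y₁).support.isClosed.isOpen_compl⟩ :=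
    ⟨_, rfl⟩
  haveI hUiso : IsIso (π₁ ∣_ U) := by rw [hUdef]; exact hπ₁.isIso_compl
  have hxU : x ∈ U := by
    rw [hUdef]
    change x ∈ ((vanishingIdeal Y₁).support : Set X)ᶜ
    rw [Set.mem_compl_iff, Scheme.IdealSheafData.coe_support_vanishingIdeal]
    exact hxY
  have hUsub : (U : Set X) ⊆ ((vanishingIdeal Y₁).support : Set X)ᶜ := by
    rw [hUdef]
    exact fun _ h => h
  have hUdisj : ∀ u : (U : Scheme.{0}), U.ι u ∉ ((vanishingIdeal Y₁).support : Set X) := by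
    intro u
    have hu : U.ι u ∈ (U : Set X) := by rw [← Scheme.Opens.range_ι U]; exact ⟨u, rfl⟩
    exact hUsub hu
  have hx'W : x' ∈ π₁ ⁻¹ᵁ U := by
    change π₁ x' ∈ U
    rw [hx']
    exact hxU
  let e : ((π₁ ⁻¹ᵁ U : X₁.Opens) : Scheme.{0}) ≅ ((U : X.Opens) : Scheme.{0}) := asIso (π₁ ∣_ U)
  have hehom : e.hom = π₁ ∣_ U := rfl
  -- the two closed points seen in the opens
  obtain ⟨hclU, hpreU⟩ := preimage_singleton_opens U x hxU hcl
  obtain ⟨hcl'W, hpreW⟩ := preimage_singleton_opens (π₁ ⁻¹ᵁ U) x' hx'W hcl'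
  have hex'W : e.hom (⟨x', hx'W⟩ : ((π₁ ⁻¹ᵁ U : X₁.Opens) : Scheme.{0})) = (⟨x, hxU⟩ : ((U : X.Opens) : Scheme.{0})) := by
    apply Subtype.ext
    rw [hehom, morphismRestrict_base_coe]
    exact hx'
  have heinv : ∀ u : ((U : X.Opens) : Scheme.{0}), e.hom (e.inv u) = u := fun u => by
    rw [← Scheme.Hom.comp_apply, e.inv_hom_id]; rfl
  have hehominv : ∀ w : ((π₁ ⁻¹ᵁ U : X₁.Opens) : Scheme.{0}), e.inv (e.hom w) = w := fun w => by
    rw [← Scheme.Hom.comp_apply, e.hom_inv_id]; rfl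
  -- the restricted blowing up `b ∣_ W`, `W = π₁⁻¹ U`, composed with `e`, is a blowing up of `U` at `x`
  have hbW : IsBlowup (b ∣_ (π₁ ⁻¹ᵁ U)) ((vanishingIdeal (⟨{x'}, hcl'⟩ : Closeds X₁)).comap (π₁ ⁻¹ᵁ U).ι) := hb.restrict _
  have hC'W : (vanishingIdeal (⟨{x'}, hcl'⟩ : Closeds X₁)).comap (π₁ ⁻¹ᵁ U).ι =
      vanishingIdeal ((⟨{x'}, hcl'⟩ : Closeds X₁).preimage (π₁ ⁻¹ᵁ U).ι.continuous) :=
    comap_vanishingIdeal_of_isOpenImmersion _ _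
  have hCinv : ((vanishingIdeal (⟨{x'}, hcl'⟩ : Closeds X₁)).comap (π₁ ⁻¹ᵁ U).ι).comap e.inv =
      vanishingIdeal ((⟨{x}, hcl⟩ : Closeds X).preimage U.ι.continuous) := by
    rw [hC'W, comap_vanishingIdeal_of_isOpenImmersion, hpreW, hpreU]
    congr 1
    apply Closeds.ext
    ext u
    constructor
    · intro h
      have h' : e.inv u = ⟨x', hx'W⟩ := h
      show u = ⟨x, hxU⟩
      rw [← heinv u, h', hex'W]
    · intro h
      have h' : u = ⟨x, hxU⟩ := h
      show e.inv u = ⟨x', hx'W⟩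
      rw [h', ← hex'W, hehominv]
  have hg : IsBlowup (b ∣_ (π₁ ⁻¹ᵁ U) ≫ e.hom) (vanishingIdeal ((⟨{x}, hcl⟩ : Closeds X).preimage U.ι.continuous)) := by
    have := hbW.comp_iso e
    rwa [hCinv] at this
  -- the near point `z` seen in `b⁻¹ W`
  have hzW : z ∈ b ⁻¹ᵁ (π₁ ⁻¹ᵁ U) := by
    change b z ∈ π₁ ⁻¹ᵁ U
    rw [hbz]
    exact hx'W
  obtain ⟨hzWcl, -⟩ := preimage_singleton_opens (b ⁻¹ᵁ (π₁ ⁻¹ᵁ U)) z hzW hzcl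
  have hgz : (b ∣_ (π₁ ⁻¹ᵁ U) ≫ e.hom) (⟨z, hzW⟩ : ((b ⁻¹ᵁ (π₁ ⁻¹ᵁ U) : B.Opens) : Scheme.{0})) =
      (⟨x, hxU⟩ : ((U : X.Opens) : Scheme.{0})) := by
    rw [Scheme.Hom.comp_apply, ← hex'W]
    congr 1
    apply Subtype.ext
    rw [morphismRestrict_base_coe]
    exact hbz
  -- THE KEY IDENTITY of controlled transforms on `b⁻¹ W`
  have hsq₁ : (b ⁻¹ᵁ (π₁ ⁻¹ᵁ U)).ι ≫ b = (b ∣_ (π₁ ⁻¹ᵁ U)) ≫ (π₁ ⁻¹ᵁ U).ι := (morphismRestrict_ι b _).symm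
  have hsq₂ : (π₁ ⁻¹ᵁ U).ι ≫ π₁ = (π₁ ∣_ U) ≫ U.ι := (morphismRestrict_ι π₁ U).symm
  have hC₁U : (vanishingIdeal Y₁).comap U.ι = ⊤ := by
    rw [← Scheme.IdealSheafData.support_eq_bot_iff, Scheme.IdealSheafData.support_comap]
    ext u
    simp only [Closeds.coe_preimage, Set.mem_preimage, Closeds.coe_bot, Set.mem_empty_iff_false, iff_false]
    exact hUdisj u
  have hJ₁W : (controlledTransform π₁ (vanishingIdeal Y₁) J μ).comap (π₁ ⁻¹ᵁ U).ι = (J.comap U.ι).comap e.hom := by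
    rw [comap_controlledTransform_of_flat U.ι hsq₂ (vanishingIdeal Y₁) J μ, hC₁U, CampaignW46.controlledTransform_top, hehom]
  have hsq₃ : 𝟙 _ ≫ (b ∣_ (π₁ ⁻¹ᵁ U) ≫ e.hom) = (b ∣_ (π₁ ⁻¹ᵁ U)) ≫ e.hom := Category.id_comp _
  have hKey : controlledTransform (b ∣_ (π₁ ⁻¹ᵁ U) ≫ e.hom) (vanishingIdeal ((⟨{x}, hcl⟩ : Closeds X).preimage U.ι.continuous))
      (J.comap U.ι) μ =
      (controlledTransform b (vanishingIdeal ⟨{x'}, hcl'⟩) (controlledTransform π₁ (vanishingIdeal Y₁) J μ) μ).comap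
        (b ⁻¹ᵁ (π₁ ⁻¹ᵁ U)).ι := by
    have h3 := comap_controlledTransform_of_flat e.hom hsq₃ (vanishingIdeal ((⟨{x}, hcl⟩ : Closeds X).preimage U.ι.continuous))
      (J.comap U.ι) μ
    rw [Scheme.IdealSheafData.comap_id] at h3
    rw [h3, comap_controlledTransform_of_flat (π₁ ⁻¹ᵁ U).ι hsq₁ _ _ μ, hJ₁W, ← hCinv, ← Scheme.IdealSheafData.comap_comp, e.hom_inv_id,
      Scheme.IdealSheafData.comap_id]
  -- data of `⟨z, hzW⟩` for the descended condition
  haveI hιiso : IsIso ((b ⁻¹ᵁ (π₁ ⁻¹ᵁ U)).ι.stalkMap (⟨z, hzW⟩ : ((b ⁻¹ᵁ (π₁ ⁻¹ᵁ U) : B.Opens) : Scheme.{0}))) :=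
    (IsOpenImmersion.iff_isIso_stalkMap.mp inferInstance).2 _
  haveI hrz' : IsRegularLocalRing (B.presheaf.stalk ((b ⁻¹ᵁ (π₁ ⁻¹ᵁ U)).ι (⟨z, hzW⟩ : ((b ⁻¹ᵁ (π₁ ⁻¹ᵁ U) : B.Opens) : Scheme.{0})))) :=
    hrz
  haveI hrzW : IsRegularLocalRing (((b ⁻¹ᵁ (π₁ ⁻¹ᵁ U) : B.Opens) : Scheme.{0}).presheaf.stalk
      (⟨z, hzW⟩ : ((b ⁻¹ᵁ (π₁ ⁻¹ᵁ U) : B.Opens) : Scheme.{0}))) :=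
    IsRegularLocalRing.of_ringEquiv
      (asIso ((b ⁻¹ᵁ (π₁ ⁻¹ᵁ U)).ι.stalkMap (⟨z, hzW⟩ : ((b ⁻¹ᵁ (π₁ ⁻¹ᵁ U) : B.Opens) : Scheme.{0})))).commRingCatIsoToRingEquiv
  have hdzW : (maximalIdeal (((b ⁻¹ᵁ (π₁ ⁻¹ᵁ U) : B.Opens) : Scheme.{0}).presheaf.stalk
      (⟨z, hzW⟩ : ((b ⁻¹ᵁ (π₁ ⁻¹ᵁ U) : B.Opens) : Scheme.{0})))).spanFinrank = 3 := by
    rw [CampaignW46.spanFinrank_eq_of_isIso_stalkMap (b ⁻¹ᵁ (π₁ ⁻¹ᵁ U)).ι]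
    exact hdz
  have hordzW : idealOrder (controlledTransform (b ∣_ (π₁ ⁻¹ᵁ U) ≫ e.hom)
      (vanishingIdeal ((⟨{x}, hcl⟩ : Closeds X).preimage U.ι.continuous)) (J.comap U.ι) μ)
      (⟨z, hzW⟩ : ((b ⁻¹ᵁ (π₁ ⁻¹ᵁ U) : B.Opens) : Scheme.{0})) = μ := by
    rw [hKey, idealOrder_comap_of_isOpenImmersion]
    exact hordz
  -- the condition descends from `X` to `U`, and applies to the blowing up `b ∣_ W ≫ e.hom` of `U` at `x`
  have hdesc := forall_near_two_le_point_of_forall_near_two_le hX3 J μ U x hxU hcl hvn hclU _ (b ∣_ (π₁ ⁻¹ᵁ U) ≫ e.hom)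
    (by rw [← hpreU]; exact hg) _ hzWcl hgz (by rw [← hpreU]; exact hordzW) hdzW hrzW
  rw [← hpreU, hKey, stalkTau_eq_of_isIso_stalkMap (b ⁻¹ᵁ (π₁ ⁻¹ᵁ U)).ι _ _ _ (stalkIdeal_comap_eq_map_stalkMap _ _ _) μ] at hdesc
  exact hdesc

end Summit.ResolutionOfSingularities.ResolutionOfSingularities.Theorems.RadicialJung.CleanModels

end
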